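import Mathlib
import Summits.Ventures.HodgeRepro2.Hypothesis
import Summits.Ventures.HodgeRepro2.BallActionU21

/-!
# `realEmbedding` through a frame is an injective group homomorphism into `U(2,1)`

`BallActionU21` shows that for a frame `Q` (`Qᴴ J21 Q = τ₁(H)`, `Q` invertible) the map
`γ ↦ realEmbedding K τ₁ Q γ = Q τ₁(γ) Q⁻¹` sends `unitaryGroup K H` into `U(2,1)` and is
multiplicative. Here it is packaged as a group homomorphism into the subgroup `u21Subgroup` of
`GL₃(ℂ)`, and shown to be injective:

* `IsFrame.realEmbeddingUnit`, `IsFrame.realEmbeddingHom : unitaryGroup K H →* u21Subgroup`,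
  `coe_realEmbeddingHom`.
* **`IsFrame.realEmbedding_injective`**: `Q τ₁(γ) Q⁻¹` determines `γ` (conjugation by the
  invertible frame and the injectivity of the field embedding `τ₁`, entrywise);
  `IsFrame.realEmbeddingHom_injective`, `IsFrame.ker_realEmbeddingHom`.

So the arithmetic group `Γ_1 ⊆ unitaryGroup K H` of `Hypothesis.lean` embeds faithfully into
`U(2,1)`, and its action on the ball (`BallActionU21`) is that of its isomorphic image.
Everything is proved; no new axioms.
-/

namespace Summit.Ventures.HodgeRepro2.ShimuraData

open Matrix

variable {K : Type*} [Field K] [NumberField K] [NumberField.IsCMField K]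
variable {τ₁ : K →+* ℂ} {H : Matrix (Fin 3) (Fin 3) K} {Q : Matrix (Fin 3) (Fin 3) ℂ}

/-- `realEmbedding K τ₁ Q γ` as an element of `u21Subgroup`, for `γ ∈ unitaryGroup K H`. -/
noncomputable def IsFrame.realEmbeddingUnit (hQ : IsFrame K τ₁ H Q) (γ : unitaryGroup K H) :
    u21Subgroup :=
  ⟨⟨realEmbedding K τ₁ Q γ, (realEmbedding K τ₁ Q γ)⁻¹,
    mul_nonsing_inv _ (hQ.isInU21_realEmbedding γ.2).isUnit_det,
    nonsing_inv_mul _ (hQ.isInU21_realEmbedding γ.2).isUnit_det⟩,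
    hQ.isInU21_realEmbedding γ.2⟩

/-- The underlying matrix of `realEmbeddingUnit`. -/
@[simp] theorem IsFrame.coe_realEmbeddingUnit (hQ : IsFrame K τ₁ H Q) (γ : unitaryGroup K H) :
    ((hQ.realEmbeddingUnit γ : GL (Fin 3) ℂ) : Matrix (Fin 3) (Fin 3) ℂ) =
      realEmbedding K τ₁ Q γ := rfl

/-- **`realEmbedding` through a frame, as a group homomorphism `unitaryGroup K H →* U(2,1)`.** -/
noncomputable def IsFrame.realEmbeddingHom (hQ : IsFrame K τ₁ H Q) :
    unitaryGroup K H →* u21Subgroup where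
  toFun := hQ.realEmbeddingUnit
  map_one' := by
    apply Subtype.ext
    apply Units.ext
    simp [hQ.realEmbedding_one]
  map_mul' γ γ' := by
    apply Subtype.ext
    apply Units.ext
    simp [hQ.realEmbedding_mul]

/-- The underlying matrix of `realEmbeddingHom γ`. -/
@[simp] theorem IsFrame.coe_realEmbeddingHom (hQ : IsFrame K τ₁ H Q) (γ : unitaryGroup K H) :
    ((hQ.realEmbeddingHom γ : GL (Fin 3) ℂ) : Matrix (Fin 3) (Fin 3) ℂ) =
      realEmbedding K τ₁ Q γ := rfl

omit [NumberField K] [NumberField.IsCMField K] in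
/-- Conjugation by an invertible frame is injective. -/
theorem IsFrame.conj_injective (hQ : IsFrame K τ₁ H Q) {A B : Matrix (Fin 3) (Fin 3) ℂ}
    (h : Q * A * Q⁻¹ = Q * B * Q⁻¹) : A = B := by
  have e1 : Q⁻¹ * Q = 1 := nonsing_inv_mul _ hQ.2
  have h' := congrArg (fun M => Q⁻¹ * M * Q) h
  simp only [Matrix.mul_assoc] at h'
  rwa [e1, mul_one, mul_one, ← mul_assoc, ← mul_assoc, e1, one_mul, one_mul] at h'

omit [NumberField K] [NumberField.IsCMField K] in
/-- **`Q τ₁(γ) Q⁻¹` determines `γ`**: `realEmbedding` through an invertible frame is injective. -/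
theorem IsFrame.realEmbedding_injective (hQ : IsFrame K τ₁ H Q) :
    Function.Injective (fun γ : GL (Fin 3) K => realEmbedding K τ₁ Q γ) := by
  intro γ γ' h
  have h1 : (γ : Matrix (Fin 3) (Fin 3) K).map τ₁ = (γ' : Matrix (Fin 3) (Fin 3) K).map τ₁ :=
    hQ.conj_injective h
  exact Units.ext (Matrix.map_injective τ₁.injective h1)

/-- `realEmbeddingHom` is injective. -/
theorem IsFrame.realEmbeddingHom_injective (hQ : IsFrame K τ₁ H Q) :
    Function.Injective hQ.realEmbeddingHom := by
  intro γ γ' h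
  apply Subtype.ext
  apply hQ.realEmbedding_injective
  have := congrArg (fun g : u21Subgroup => ((g : GL (Fin 3) ℂ) : Matrix (Fin 3) (Fin 3) ℂ)) h
  simpa using this

/-- The kernel of `realEmbeddingHom` is trivial. -/
theorem IsFrame.ker_realEmbeddingHom (hQ : IsFrame K τ₁ H Q) : hQ.realEmbeddingHom.ker = ⊥ :=
  (MonoidHom.ker_eq_bot_iff _).2 hQ.realEmbeddingHom_injective

end Summit.Ventures.HodgeRepro2.ShimuraData
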